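import Summits.AnomalousDissipation.AnomalousDissipation.Theorems.ImpulseGridGridSignsLawSteadyNecessary
import Literature.Analysis.FunctionSpaces.TorusCalculusProofs

/-!
# Route ImpulseGrid (AnomalousDissipation) — where the crux `GridSigns` sits in the route

Support file for the crux `GridSigns` (item stmt-AnomalousDissipation-1771), line `SketchIdeator2`
(lead c1). Two formal arrows of the route's "logical map"
(`Theses/ImpulseGrid.lean`, rationale §RANKED CRUXES):

* `gridSigns_of_gridThesis : GridThesis → GridSigns` — the target (stmt-1770) drops onto the crux
  by forgetting the per-`j` sup-energy and no-leakage clauses (so 1771 closes the moment 1770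
  does);
* `boundedEnergyGrid_of_gridSigns : GridSigns → BoundedEnergyGrid` — every witness of the crux is
  in particular a witness of `BoundedEnergyGrid` (stmt-10430): the slab profile `Φ = ∂₀Ψ + 1`
  inherits `x⊥`-invariance from `Ψ`, has unit mass `∫Φ = 1` by `∫∂₀Ψ = 0`
  (`Torus.integral_partialDeriv_eq_zero_holds`), and the force `Φ•G` is nonzero because the
  early-relaxation sign (b) with `η > 0` is false for `G = 0` (the `Ψ•G`-pairing vanishes
  identically, and a generalized limit of the zero functional is `0`).

Hence no line can close `GridSigns` without producing a `ν`-uniformly bounded-energy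
vanishing-viscosity Leray–Hopf family under a FIXED nonzero force — the content of stmt-10430,
reduced by its two leads to the Constantin–Tarfulea–Vicol open problem (arXiv:1305.7089, p. 3).
No new definitions.
-/

noncomputable section

-- `Summit.<Summit>.<Problem>` is the tree's mandated summit-side namespace (CONVENTIONS §2); for this
-- single-conjunct summit the two coincide, so the duplicate is deliberate.
set_option linter.dupNamespace false

open MeasureTheory Set Filter Topology
open scoped InnerProductSpace RealInnerProductSpace

namespace Summit.AnomalousDissipation.AnomalousDissipation.Theorems.GridSignsCeilings

open Literature.Analysis
open Literature.Analysis.FluidPDE Literature.Analysis.FluidPDE.Torus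
open Literature.Analysis.FunctionSpaces Literature.Analysis.FunctionSpaces.Torus
open Summit.AnomalousDissipation.AnomalousDissipation.Theses.ImpulseGrid

/-- **The target drops onto the crux**: `GridThesis → GridSigns` (forget the per-`j` sup-energy
bound and the no-leakage clause; every other clause is copied). [folklore] -/
theorem gridSigns_of_gridThesis : GridThesis → GridSigns := by
  rintro ⟨Φ, Ψ, G, c, η, Λ, hΦ, hΨ, hG, hΨinv, hGinv, hG0, hGdiv, hΨ', hnorm, hf1, hf2, hf3, hc, hη,
    ν, u₀, u, hν, hν0, hLH, -, hmom, hE, -, ha, hb⟩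
  exact ⟨Φ, Ψ, G, c, η, Λ, hΦ, hΨ, hG, hΨinv, hGinv, hG0, hGdiv, hΨ', hnorm, hf1, hf2, hf3, hc, hη,
    ν, u₀, u, hν, hν0, hLH, hmom, hE, ha, hb⟩

/-- A streamwise partial derivative of a field invariant under the translations along another
axis is again invariant under them (translations commute). [folklore] -/
theorem partialDeriv_zero_add_single_of_invariant {Ψ : UnitAddTorus (Fin 3) → ℝ} {i : Fin 3}
    (hinv : ∀ (s : UnitAddCircle) (y : UnitAddTorus (Fin 3)), Ψ (y + Pi.single i s) = Ψ y)
    (s : UnitAddCircle) (x : UnitAddTorus (Fin 3)) :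
    Torus.partialDeriv 0 Ψ (x + Pi.single i s) = Torus.partialDeriv 0 Ψ x := by
  unfold Torus.partialDeriv Torus.lineDeriv
  congr 1
  funext t
  rw [add_right_comm, hinv]

/-- A profile invariant along axes `1` and `2` that vanishes on a whole `x₀`-circle vanishes
identically (every point is reached from that circle by translations along axes `1`, `2`). [folklore] -/
theorem eq_zero_of_slab_of_forall_add_single_zero {Φ : UnitAddTorus (Fin 3) → ℝ}
    (hΦinv : ∀ (s : UnitAddCircle) (y : UnitAddTorus (Fin 3)),
      Φ (y + Pi.single (1 : Fin 3) s) = Φ y ∧ Φ (y + Pi.single (2 : Fin 3) s) = Φ y)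
    {x : UnitAddTorus (Fin 3)} (hx : ∀ s : UnitAddCircle, Φ (x + Pi.single (0 : Fin 3) s) = 0)
    (y : UnitAddTorus (Fin 3)) : Φ y = 0 := by
  have hy : y = x + Pi.single (0 : Fin 3) ((y - x) 0) + Pi.single (1 : Fin 3) ((y - x) 1)
      + Pi.single (2 : Fin 3) ((y - x) 2) := by
    have h := Finset.univ_sum_single (y - x)
    rw [Fin.sum_univ_three] at h
    calc y = x + (y - x) := by abel
      _ = x + (Pi.single (0 : Fin 3) ((y - x) 0) + Pi.single (1 : Fin 3) ((y - x) 1)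
            + Pi.single (2 : Fin 3) ((y - x) 2)) := by rw [h]
      _ = _ := by abel
  rw [hy, (hΦinv _ _).2, (hΦinv _ _).1, hx]

/-- **Every witness of the crux is a bounded-energy grid family**: `GridSigns → BoundedEnergyGrid`
(stmt-1771 ⇒ stmt-10430). The design of `GridSigns` supplies `Φ = ∂₀Ψ + 1`, hence `Φ` is
`x⊥`-invariant and `∫Φ = 1` (`∫∂₀Ψ = 0`); the force `Φ•G` is nonzero since otherwise `G ≡ 0`
(unit mass forbids `Φ` to vanish on an `x₀`-circle, and `G` is `x₀`-invariant), which makes the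
early-relaxation functional (b) identically zero, contradicting `(b) ≤ −η < 0`; the family, the
drift data and the mean-energy bound are copied. [folklore] -/
theorem boundedEnergyGrid_of_gridSigns : GridSigns → BoundedEnergyGrid := by
  rintro ⟨Φ, Ψ, G, c, η, Λ, hΦ, hΨ, hG, hΨinv, hGinv, hG0, hGdiv, hΨ', hnorm, hf1, hf2, hf3, hc, hη,
    ν, u₀, u, hν, hν0, hLH, hmom, hE, ha, hb⟩
  -- `Φ = ∂₀Ψ + 1`
  have hΦeq : ∀ x, Φ x = Torus.partialDeriv 0 Ψ x + 1 := fun x => by rw [hΨ' x]; ring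
  -- `Φ` is `x⊥`-invariant
  have hΦinv : ∀ (s : UnitAddCircle) (x : UnitAddTorus (Fin 3)),
      Φ (x + Pi.single (1 : Fin 3) s) = Φ x ∧ Φ (x + Pi.single (2 : Fin 3) s) = Φ x := by
    intro s x
    refine ⟨?_, ?_⟩
    · rw [hΦeq, hΦeq x, partialDeriv_zero_add_single_of_invariant (fun s y => (hΨinv s y).1)]
    · rw [hΦeq, hΦeq x, partialDeriv_zero_add_single_of_invariant (fun s y => (hΨinv s y).2)]
  -- unit mass
  have hΦint : ∫ x, Φ x = 1 := by
    have hi : Integrable (fun x => Torus.partialDeriv 0 Ψ x) volume :=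
      (hΨ.partialDeriv 0).continuous.integrable_of_hasCompactSupport
        (HasCompactSupport.of_compactSpace _)
    simp_rw [hΦeq]
    rw [integral_add hi (integrable_const _), integral_partialDeriv_eq_zero_holds hΨ 0,
      integral_const, smul_eq_mul, mul_one, zero_add, probReal_univ]
  -- the force is nonzero
  have hfne : (fun x => Φ x • G x) ≠ 0 := by
    intro hf0
    -- `G ≡ 0`
    have hGz : ∀ x, G x = 0 := by
      intro x
      by_contra hGx
      have hx : ∀ s : UnitAddCircle, Φ (x + Pi.single (0 : Fin 3) s) = 0 := by
        intro s
        have h1 : Φ (x + Pi.single (0 : Fin 3) s) • G (x + Pi.single (0 : Fin 3) s) = 0 :=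
          congr_fun hf0 (x + Pi.single (0 : Fin 3) s)
        rw [hGinv] at h1
        rcases smul_eq_zero.1 h1 with h | h
        · exact h
        · exact absurd h hGx
      have hzero : ∀ y, Φ y = 0 := eq_zero_of_slab_of_forall_add_single_zero hΦinv hx
      have : ∫ y, Φ y = 0 := by simp_rw [hzero]; exact integral_zero _ _
      rw [hΦint] at this
      exact one_ne_zero this
    -- the early-relaxation functional vanishes identically
    have hV : (fun y => Ψ y • G y) = fun _ => (0 : EuclideanSpace ℝ (Fin 3)) :=
      funext fun y => by rw [hGz y, smul_zero]
    have hconv : ∀ (U : UnitAddTorus (Fin 3) → EuclideanSpace ℝ (Fin 3)) (x : UnitAddTorus (Fin 3)),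
        Torus.convect U (fun _ => (0 : EuclideanSpace ℝ (Fin 3))) x = 0 := by
      intro U x
      unfold Torus.convect Torus.fderiv
      rw [show liftAt (fun _ : UnitAddTorus (Fin 3) => (0 : EuclideanSpace ℝ (Fin 3))) x =
        fun _ => 0 from rfl]
      simp
    have hb0 := hb 0
    rw [hV] at hb0
    simp_rw [hconv, inner_zero_right, integral_zero] at hb0
    rw [steady_longTimeAvg_const] at hb0
    linarith
  exact ⟨Φ, G, c, hΦ, hG, hΦinv, hΦint, hGinv, hG0, hf1, hf2, hf3, hfne, hc, ν, u₀, u, hν, hν0,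
    hLH, hmom, hE⟩

end Summit.AnomalousDissipation.AnomalousDissipation.Theorems.GridSignsCeilings

end
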